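import Mathlib
import HarnessLib
import HarnessLib.Audit
import Summits.AtomisticToContinuum.Statement
import Literature.MathematicalPhysics.StatisticalMechanics.LennardJonesClusters
import Literature.Geometry.DiscreteGeometry.KissingPatterns
import Literature.MathematicalPhysics.StatisticalMechanics.HaggStacking
import Literature.MathematicalPhysics.StatisticalMechanics.BarlowStacking
import HarnessLib.Audit.Status.Attr

/-!
Route: CrystalKissingRigidity

CLOSED (retired) 2026-08-15T13:41:29Z by operator:999:1257524 — reason: not-a-thesis: assembly does not conclude the sub-problem Statement — note: D-0027 §2.1 audit (human 2026-08-15: routes that do not decide the summit are removed): the assembly concludes `Literature.MathematicalPhysics.StatisticalMechanics.Crystallization`, not the sub-problem statement; a NEW conforming route may be opened from the same idea (generated `closes : … → _root_. The file is kept as the record of this route; refuted decls are indexed as negative knowledge (`ledger negatives`).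

X_A (KISSING RIGIDITY; it suffices to show, for Lennard-Jones V = r⁻¹²/12 − r⁻⁶/6 in ℝ³, ground
states x^N):
 (K1) SOFT TWELVE-COORDINATION [typed: SoftTwelveCoordination]: for every η ∈ (0, 3/10) all but o(N)
particles of x^N have
      EXACTLY twelve other particles within distance 1+η and none in (1+η, 5/4). Mechanism: Hales'
Flyspeck inequality
      Σ_v L(‖v‖/2) ≤ 12 with L(h) = (1.26 − h)/0.26 (Hales2012, Lemma 1 = [Hal12a]) caps the soft
coordination at 12; the
      LJ energy identity E = −(1/12)·#{soft bonds} + elastic + non-bonded tail (LucaFriesecke2016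
(v)–(vi), 3-D version) and
      E(N) ≤ N·e(HCP) + O(N^{2/3}) force twelve bonds on all but o(N) particles.
 (K2) ROBUST FEJES TÓTH–HALES [informal until fcc/hcp kissing patterns are defined]: ∃ η₀ > 0, C: if
every point of a set
      S ⊂ B_R(p) with pairwise distances ≥ 1 − η (η < η₀) is softly twelve-coordinated in the sense
of (K1), then the twelve-shell
      of every point of S ∩ B_{R/2}(p) is Cη-close, up to a rotation, to the FCC or the HCP kissing
pattern; hence
      (Hales2012, Sec. 1 + [Hal12a, Sec. 1.3]) S ∩ B_{R/2}(p) is C(R)η-close to a fragment of a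
Barlow stacking of hexagonal layers.
      η = 0 is Hales2012, Thm 1 (Fejes Tóth's conjecture).
 (K3) STACKING SELECTION (shared with routes CrystalLocalRigidity (c) / RefuteCrystalPeriodicMin:
Hägg domination 0716/0737 +
      certified J_k): among Barlow stackings the LJ energy per particle is uniquely minimised by the
period-2 (HCP-type) stacking
      with a gap |J_2| − Σ_{k≥3} k|J_k| > 0 per misaligned layer pair; hence a ground state carries
≤ K (independent of N) fault
      planes (fault cost ≍ |J_2| N^{2/3} vs. total surface energy ≤ C N^{2/3}).
 (K1)+(K2)+(K3) ⇒ BulkDefectVanish [typed]: for one periodic P (the LJ-optimal HCP) and every R, ε,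
all but o(N) particles have
 their R-neighbourhood ε-matched by an isometric copy of P's R-window ⇒ (DefectVanishCrystallizes,
soft) IsCrystallizing; the
 periodic analogue of (K1)–(K3) gives e(Q) ≥ e(P) for every periodic Q ⇒ periodic minimum attained;
E(N)/N → e(P) is bookkeeping
 (periodisation 0715 + trial blocks 0629).
Lean (formal shadow, all constants exist):
  BulkDefectVanish → Literature.MathematicalPhysics.StatisticalMechanics.LennardJonesMinimalDistance
  → (∃ P : Literature.MathematicalPhysics.StatisticalMechanics.PeriodicConfiguration 3, IsLeast
(Set.range fun Q : Literature.MathematicalPhysics.StatisticalMechanics.PeriodicConfiguration 3 =>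
       Q.energyPerParticle Literature.MathematicalPhysics.StatisticalMechanics.lennardJones)
(P.energyPerParticle Literature.MathematicalPhysics.StatisticalMechanics.lennardJones))
  → Filter.Tendsto (fun N : ℕ =>
Literature.MathematicalPhysics.StatisticalMechanics.groundStateEnergy
Literature.MathematicalPhysics.StatisticalMechanics.lennardJones 3 N / N) Filter.atTop
       (nhds (⨅ Q : Literature.MathematicalPhysics.StatisticalMechanics.PeriodicConfiguration 3,
Q.energyPerParticle Literature.MathematicalPhysics.StatisticalMechanics.lennardJones))
  → Literature.MathematicalPhysics.StatisticalMechanics.Crystallization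

Rationale: WHY THIS LINE. Every proved crystallization theorem for realistic potentials descends from the
sticky limit (HeitmannRadin1980;
Theil2006; FlatleyTheil2015; BlancLewin2015 §2.3 p.11), and in 2-D the cleanest proof is
COMBINATORIAL: bound the number of
bonds of the contact graph and read off rigidity (Harborth; LucaFriesecke2016 via discrete
Gauss–Bonnet). The 3-D combinatorial
inputs now EXIST but have never been connected to Lennard-Jones: Hales2012 proves Fejes Tóth's
conjecture (a packing in which
every ball touches twelve others consists of hexagonal layers, Thm 1) using the Flyspeck inequality
Σ L(‖v‖/2) ≤ 12 (Lemma 1),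
which is already a SOFT statement (neighbours up to distance 2h₀ = 2.52 radii are weighted);
Bezdek2011 bounds contact numbers
of finite packings (6N − c N^{2/3}). Route CrystalLocalRigidity asks for a Flyspeck-type LOCAL
ENERGY inequality e_loc ≥ e* with
equality iff Barlow; this route instead splits the work into (K1) an energy-to-combinatorics
reduction whose only geometric
input is the twelve-neighbour cap, and (K2) a purely metric-geometric ROBUST kissing-twelve theorem
(no potential), so that the
"equality iff Barlow" analysis is outsourced to Hales' classification rather than to interval
arithmetic over R-neighbourhoods.
Imported areas: discrete geometry of sphere packings (Flyspeck/Hales2012, Bezdek2011), discrete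
differential geometry
(LucaFriesecke2016), 1-D lattice-gas ground states for (K3) (RadinSchulman1983, HaggStacking.lean).
RANKED CRUXES:
 2. RobustFejesTothHales (K2) [informal; definition requests fccKissingPattern/hcpKissingPattern,
BarlowStacking]. Hardest and
    most informative: a stability version of Hales2012 Thm 1 at positive slack η. Geometric
frustration (icosahedral shells are
    softly twelve-coordinated but cannot propagate) is exactly what it must quantify.
 3. SoftTwelveCoordination (K1) [typed]. LJ-specific; needs the L12 inequality vendored as a
Literature fact + energy accounting
    with the r⁻⁶ tail; false iff LJ ground states have a positive fraction of ≠12-coordinated bulk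
particles.
 4. BulkDefectVanish [typed] — the hinge (K1)+(K2)+(K3) ⇒ vanishing defect fraction w.r.t. one
periodic P.
 5. periodic minimum attained (shared item 0627) via the periodic analogue of (K1)–(K3).
 support: DefectVanishCrystallizes [typed, soft: compactness of O(3), vague-limit bookkeeping, m ≡ 1
from minimal distance];
 StackingFaultBound [informal]: ≤ K fault planes per ground state.
KILL CRITERIA. (K2) refuted at every η > 0 (a non-layered Delone set in ℝ³, all points softly
twelve-coordinated with slack
η arbitrarily small — e.g. a bounded-strain polytetrahedral structure) closes THIS route. (K1)
refuted (LJ bulk not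
twelve-coordinated: numerics contradicting Stillinger2001's hcp/fcc ground state) refutes every
sphere-packing-heritage route.
Refutation of 0627 kills the conjunct (route RefuteCrystalPeriodicMin; its own numerics J_2 ≈
−7.3e−5, |J_2|/Σk|J_k| ≈ 250 say no).
NOT DECOMPOSED YET: the value of η₀ vs. the actual bond-length spread of LJ ground states (must be
compatible: (K1) with η < η₀);
the elastic term; surface/Wulff N^{2/3} constants; rotations of fault planes; the periodic analogue
in rank 5. All wait for
crux 2 or 3 to move.
SOURCES: Hales2012 (arXiv:1209.6043) Thm 1, Lemma 1, Lemma 2; Bezdek2011 (arXiv:1102.1198);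
LucaFriesecke2016
(arXiv:1605.00034); HeitmannRadin1980; Theil2006; FlatleyTheil2015; BlancLewin2015 §2.2–2.3;
Stillinger2001; PartayOrtnerCsanyi2017.

Novelty: NOVELTY (retriage 2026-08-14; searched: lit frontier/bridges AtomisticToContinuum, lit
search/vsearch "12-neighbour packings", "stability Fejes Toth kissing twelve", "3-D Lennard-Jones
crystallization", zbMATH/Crossref for Böröczky–Szabó, barrier catalogue).
Nearest prior art. (1) η = 0 classification: Hales2012 (arXiv:1209.6043) Thm 1 + Lemma 1 (Flyspeck
L12, in tree as Literature.Geometry.DiscreteGeometry.flyspeck_L12 / Hales2012_kissingTwelve) and,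
independently, BoroczkySzabo2015 (doi:10.1007/s10474-015-0527-4, geometric proof via the
Musin–Tarasov strong thirteen-spheres theorem) — both for EXACT contact only. (2) The only printed
study of the relaxed condition is BoroczkySzabo2016 (doi:10.1007/s10474-016-0583-4):
ε-quasi-twelve-neighbour packings (no contacts, twelve centres within 2+ε of every centre) are
CONSTRUCTED for every ε > 0 "with some surprising properties" — a construction paper, not a
stability theorem; text paywalled (acq-00697), so whether it already defeats crux K2 under K2's
extra hypotheses (exactly twelve within 1+η, empty annulus (1+η, 5/4)) is the first thing to check.
(3) Single-shell flexibility: KusnerKusnerLagariasShlosman2018 (arXiv:1611.10297). (4) The 2-D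
template being transplanted: HeitmannRadin1980, Theil2006, LucaFriesecke2016 (bond count + discrete
Gauss–Bonnet); 3-D with a three-body term: FlatleyTheil2015; contact-number bounds Bezdek2011;
lattice-only energetics BeterminSamajTravenec2022 (arXiv:2107.14020); status "completely open in d  [refs: 10.1007/s10474-015-0527-4, 10.1007/s10474-016-0583-4, 1209.6043, 1611.10297, 2107.14020, 2604.19239, 2407.20762, doi:10.1007/s10474-015-0527-4, doi:10.1007/s10474-016-0583-4, Hales2012, BoroczkySzabo2015, BoroczkySzabo2016, KusnerKusnerLagariasShlosman2018, HeitmannRadin1980, Theil2006, LucaFriesecke2016, FlatleyTheil2015, Bezdek2011, BeterminSamajTravenec2022, BlancLewin2015]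

Barriers (technique_class: sphere-packing-reduction contact-graph local-rigidity): technique_class: sphere-packing-reduction contact-graph local-rigidity
- Literature.Barriers.AtomisticToContinuum.KissingTwelveDegeneracy: APPLIES (this is the
contact-graph transplant it names): twelve contacts at every ball force hexagonal layers but never a
particular stacking (every Hägg walk, aperiodic included, is kissing-twelve). Evasion = its evasions
(ii)+(iv): K1/K2 conclude only "Barlow fragment up to o(N) defects"; the stacking is selected by the
r⁻⁶ tail acting beyond the second shell through the interlayer couplings J_k and Hägg domination
(hinge 0751, support 0759, shared items 0716/0737/0670) — numerics-backed (J₂ ≈ −7.3e−5), the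
declared residual risk.
- Literature.Barriers.AtomisticToContinuum.FlexibleKissingArrangements: APPLIES to K2: one soft
twelve-shell is not rigid (icosahedral witness 1/40-far from FCC/HCP, open set of kissing
arrangements; KKLS arXiv:1611.10297). Evasion = its evasion (i): K2 assumes EVERY point of S ∩ B_R
is softly twelve-coordinated AND has an empty annulus (1+η, 5/4) (the analogue of Hales's class 𝒱,
Lemma 2 gap 2h₀), and concludes only on B_{R/2}; the bare icosahedral shell violates the annulus
hypothesis for η < 0.0515 (shell–shell distance 1.0515) while Mackay icosahedra satisfy every
hypothesis once η ≳ 0.05, so η₀ ≲ 1/20 is forced. The bet: propagation gives rigidity with a LINEAR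
rate Cη — unproved; BoroczkySzabo2016 (ε-quasi-twelve-neighbour constructions, unread, acq-00697) is
the standing threat.
- Literature.Barriers.Ato

History (route lifecycle, newest last):
- 2026-08-15T13:41:29Z · CLOSED retired — not-a-thesis: assembly does not conclude the sub-problem Statement (operator:999:1257524)

sub-problem: Crystallization · status: closed(retired) · opened planner-plan-AtomisticToContinuum-Crystallization-0 2026-08-13T19:08:11Z · rev 2 · ledger route-AtomisticToContinuum-CrystalKissingRigidity
GENERATED by the gate from the ledger (D-0016/17). Provers cite these decls: `theorem foo : Summit.AtomisticToContinuum.Crystallization.Theses.CrystalKissingRigidity.<Decl> := …` in Summits/AtomisticToContinuum/Crystallization/Theorems/<Name>.lean.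
-/

namespace Summit.AtomisticToContinuum.Crystallization.Theses.CrystalKissingRigidity

open scoped BigOperators Topology Manifold Classical MeasureTheory ProbabilityTheory Matrix InnerProductSpace ComplexConjugate ContinuousMap
open Filter Set Function TopologicalSpace MeasureTheory

attribute [summit_statement] _root_.Crystallization

/-- item stmt-AtomisticToContinuum-0758 · crux · rank 2 · closed · moot by None · by planner
why it might fail: No η>0 version in print: one soft 12-shell is flexible (KKLS; FlexibleKissingArrangements), so rigidity must propagate from all of S∩B_R with η₀≲1/20 and an unproved LINEAR rate Cη; BoroczkySzabo2016 build ε-quasi-12-neighbour packings ∀ε 'with surprising properties' (unread) — may break it.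
sources: BoroczkySzabo2016 doi:10.1007/s10474-016-0583-4 (ε-quasi-twelve-neighbour constructions for every ε; paywalled, acq-00697), Hales2012 arXiv:1209.6043 Thm 1, Lemma 2 (η = 0 only); in tree Literature.Geometry.DiscreteGeometry.Hales2012_kissingTwelve, hales2012_kissingTwelve_of_L12 (FejesTothKissingTwelve.lean:171/438), KusnerKusnerLagariasShlosman2018 arXiv:1611.10297 p.12 (continuous deformations between FCC, HCP, DOD shells), Literature.Barriers.AtomisticToContinuum.FlexibleKissingArrangements (icosahedral witness 1/40-far from both patterns; open set of kissing arrangements), BoroczkySzabo2015 doi:10.1007/s10474-015-0527-4 (independent η = 0 proof via Musin–Tarasov strong thirteen spheres; acq-00699)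
[crux] (K2) ROBUST FEJES TÓTH–HALES (pure metric geometry, no potential): there are η₀ > 0 and C < ∞
such that for every η ∈ (0, η₀), every R ≥ R₀ and every finite S ⊂ B_R(p) ⊂ ℝ³ with pairwise
distances ≥ 1 − η in which every point has exactly twelve points of S ∪ (exterior) within distance 1
+ η and none at distance in (1 + η, 5/4): the twelve-shell of every point of S ∩ B_{R/2}(p) is,
after a rotation, Cη-close to the FCC kissing pattern (cuboctahedron) or the HCP kissing pattern
(anticuboctahedron), and consequently S ∩ B_{R/2}(p) is C(R)η-close to a rigid-motion image of a
fragment of a Barlow stacking of triangular layers (spacing 1). The case η = 0, S infinite is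
Hales2012 Thm 1 (Fejes Tóth conjecture) + [Hal12a, Sec. 1.3] (FCC/HCP pattern everywhere ⇒ hexagonal
layers); Hales2012 Lemma 2 (gap: no distances in (2, 2h₀), h₀ = 1.26, in kissing-twelve packings) is
the origin of the 5/4 gap. Frustration content: an icosahedral shell is softly twelve-coordinated
for η ≳ 0.05 but its neighbours cannot all be; the statement quantifies that polytetrahedral order
cannot propagate. To be typed once fccKissingPattern / hcpKissingPattern / BarlowStacking are
defined (definition requests -/
@[route_item "route-AtomisticToContinuum-CrystalKissingRigidity"]
def RobustFejesTothHales : Prop :=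
  ∃ η₀ C R₀ : ℝ, ∃ C' : ℝ → ℝ, 0 < η₀ ∧ ∀ η : ℝ, 0 < η → η < η₀ → ∀ R : ℝ, R₀ ≤ R → ∀ (p : EuclideanSpace ℝ (Fin 3)) (S : Set (EuclideanSpace ℝ (Fin 3))), (∀ x ∈ S, ∀ y ∈ S, x ≠ y → 1 - η ≤ dist x y) → (∀ x ∈ S, dist x p ≤ R → {y ∈ S | y ≠ x ∧ dist x y ≤ 1 + η}.ncard = 12 ∧ ∀ y ∈ S, ¬ (1 + η < dist x y ∧ dist x y < 5 / 4)) → (∀ x ∈ S, dist x p ≤ R / 2 → ∃ T : Finset (EuclideanSpace ℝ (Fin 3)), (↑T : Set (EuclideanSpace ℝ (Fin 3))) = (fun y => y - x) '' {y ∈ S | y ≠ x ∧ dist x y ≤ 1 + η} ∧ (Literature.Geometry.DiscreteGeometry.ShellCloseTo (C * η) T Literature.Geometry.DiscreteGeometry.fccKissingPattern ∨ Literature.Geometry.DiscreteGeometry.ShellCloseTo (C * η) T Literature.Geometry.DiscreteGeometry.hcpKissingPattern)) ∧ (∃ (s : ℤ → ℤ) (g : EuclideanSpace ℝ (Fin 3)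 ≃ᵃⁱ[ℝ] EuclideanSpace ℝ (Fin 3)), Literature.MathematicalPhysics.StatisticalMechanics.IsHaggSeq s ∧ ∀ x ∈ S, dist x p ≤ R / 2 → ∃ z ∈ Literature.MathematicalPhysics.StatisticalMechanics.barlowStacking 1 (Real.sqrt (2 / 3)) s, dist x (g z) ≤ C' R * η)

/-- item stmt-AtomisticToContinuum-0750 · crux · rank 3 · closed · moot by None · by planner
why it might fail: Crystallization-strength for LJ: false iff a positive fraction of bulk particles is not softly 12-coordinated (persistent icosahedral/polytetrahedral order; LJ₁₃ is icosahedral). Gap: L12 caps neighbours only within 1.26·d_min, d_min<1 for LJ, so η∈(0.22,0.3) and elastic/tail bookkeeping are open.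
sources: Hales2012 arXiv:1209.6043 Lemma 1 (L12 for PACKINGS, h₀ = 1.26); Literature.Geometry.DiscreteGeometry.flyspeck_L12 (FlyspeckL12.lean:77), BlancLewin2015 arXiv:1504.01153 §2.2 (d_min), §2.3 p.7 ('completely open in dimension three'); Literature.MathematicalPhysics.StatisticalMechanics.LennardJonesMinimalDistance, Literature.Barriers.AtomisticToContinuum.IcosahedralClusters (LJ13: both close-packed first shells lose to the icosahedron), LucaFriesecke2016 arXiv:1605.00034 §3 (3.3)/(3.7) (bond/elastic/non-bonded decomposition, d = 2), grounder g9-7 / refuter g28-4 notes 2026-08-13 on stmt-0750 (L12 scale mismatch: cap valid only for η ≲ 1.26·d_min − 1 ≈ 0.22)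
[crux] (K1) SOFT TWELVE-COORDINATION: for every η ∈ (0, 3/10) and every sequence of Lennard-Jones
ground states x^N in ℝ³, the fraction of particles i that do NOT have exactly twelve other particles
within distance 1+η and no particle at distance in (1+η, 5/4) tends to 0 (bulk: 12 neighbours at a*
≈ 0.971, next shell at √2·a* ≈ 1.373 for every Barlow stacking; surface fraction O(N^{-1/3});
interior strain O(N^{-1/3})). Mechanism: Hales2012 Lemma 1 (Flyspeck L12 inequality Σ L(‖v‖/2) ≤ 12,
h₀ = 1.26) caps soft coordination at 12; LJ bond/elastic/tail decomposition (LucaFriesecke2016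
(v)-(vi) in 3-D) + E(N) ≤ N e(HCP) + O(N^{2/3}) forces 12. Sources: Hales2012, LucaFriesecke2016,
Stillinger2001. -/
@[route_item "route-AtomisticToContinuum-CrystalKissingRigidity"]
def SoftTwelveCoordination : Prop :=
  ∀ η : ℝ, 0 < η → η < 3 / 10 → ∀ x : (N : ℕ) → (Fin N → EuclideanSpace ℝ (Fin 3)), (∀ N, Literature.MathematicalPhysics.StatisticalMechanics.IsGroundState Literature.MathematicalPhysics.StatisticalMechanics.lennardJones (x N)) → Filter.Tendsto (fun N : ℕ => (Nat.card {i : Fin N // ¬ (Nat.card {j : Fin N // j ≠ i ∧ dist (x N i) (x N j) ≤ 1 + η} = 12 ∧ ∀ j : Fin N, j ≠ i → dist (x N i) (x N j) ≤ 1 + η ∨ 5 / 4 ≤ dist (x N i) (x N j))} : ℝ) / N) Filter.atTop (nhds 0)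

/-- item stmt-AtomisticToContinuum-0751 · crux · rank 4 · open · by planner
why it might fail: As typed P sits at a point of P for EVERY good particle ⇒ limit crystal must be vertex-transitive: fine for HCP/FCC, FALSE for dhcp/'hc' polytypes (stable near the fcc/hcp line for truncated LJ) even if Crystallization holds; also needs K1∧K2∧K3 with HCP optimal by ~1e-4 (J₂≈−7.3e−5 uncertified).
sources: PartayOrtnerCsanyi2017 arXiv:1705.01751 p.4 (hcp favoured at low pressure; hc/hhc polytypes stable near the fcc/hcp boundary; p.2 fcc-vs-hcp dispute), refuter g28-4 note 2026-08-13T19:38Z on stmt-0751 (vertex-transitivity requirement; safer variant x_i + A(P.points − p), p ∈ P.points), stmt-AtomisticToContinuum-0670 (certified interlayer couplings J_k wanted; J₂ ≈ −7.3e−5 is route-internal numerics), Literature.Barriers.AtomisticToContinuum.ShortRangeStackingBlindness (selection needs the tail beyond √(8/3)), BlancLewin2015 arXiv:1504.01153 §2.3; FlatleyTheil2015 arXiv:1407.0692 Thm 1.1 (nearest 3-D theorem: fcc, with three-body term)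
[crux] HINGE: there is ONE periodic configuration P (the LJ-optimal HCP-type stacking, 0 ∈ motif)
such that for every window radius R and tolerance ε, in every sequence of LJ ground states all but
o(N) particles i admit a linear isometry A with the particles in B_R(x_i) ε-matched both ways to x_i
+ A(P.points ∩ B_R). Follows from (K1) SoftTwelveCoordination + (K2) RobustFejesTothHales + (K3)
stacking selection (Hägg domination 0716/0737 + certified J_k) with ≤ K fault planes per ground
state. Sources: Hales2012 Thm 1; HaggStacking.lean; PartayOrtnerCsanyi2017. -/
@[route_item "route-AtomisticToContinuum-CrystalKissingRigidity", crux]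
def BulkDefectVanish : Prop :=
  ∃ P : Literature.MathematicalPhysics.StatisticalMechanics.PeriodicConfiguration 3, ∀ R ε : ℝ, 0 < R → 0 < ε → ∀ x : (N : ℕ) → (Fin N → EuclideanSpace ℝ (Fin 3)), (∀ N, Literature.MathematicalPhysics.StatisticalMechanics.IsGroundState Literature.MathematicalPhysics.StatisticalMechanics.lennardJones (x N)) → Filter.Tendsto (fun N : ℕ => (Nat.card {i : Fin N // ¬ ∃ A : EuclideanSpace ℝ (Fin 3) →ₗᵢ[ℝ] EuclideanSpace ℝ (Fin 3), (∀ p ∈ P.points, ‖p‖ ≤ R → ∃ j : Fin N, dist (x N j) (x N i + A p) ≤ ε) ∧ (∀ j : Fin N, dist (x N j) (x N i) ≤ R → ∃ p ∈ P.points, dist (x N j) (x N i + A p) ≤ ε)} : ℝ) / N) Filter.atTop (nhds 0)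

/-- item stmt-AtomisticToContinuum-0627 · crux · rank 5 · open · by planner
why it might fail: False iff no periodic configuration attains inf e_LJ: stackings of growing period tending to an aperiodic Barlow optimum (route RefuteCrystalPeriodicMin), i.e. Hägg domination |J₂|>Σk|J_k| fails (1e-4 margin); print covers Bravais lattices only; 1-D long-range chains admit aperiodic ground states.
sources: BlancLewin2015 arXiv:1504.01153 §2.5 p.11 (only Bravais lattices treated; HCP excluded; 'still an open problem'), BeterminSamajTravenec2022 arXiv:2107.14020 (3-D lattice ground states for LJ-type energies: Bravais lattices + hcp comparison, numerics), Literature.Barriers.AtomisticToContinuum.Hubbard1978_mostHomogeneous (aperiodic ground states of 1-D infinite-range chains), Literature.Barriers.AtomisticToContinuum.HcpNotBravais; PartayOrtnerCsanyi2017 arXiv:1705.01751 p.4, stmt-AtomisticToContinuum-0716/0737 (Hägg domination, open) and stmt-AtomisticToContinuum-0670 (certified J_k, open)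
The infimum over periodic configurations of ℝ³ of the Lennard-Jones energy per particle is attained
(by some lattice G and finite motif F). Needs stacking selection (c) + compactness of near-optimal
periodic configurations at bounded density / bounded-below distances; refuted if optimal LJ
stackings are aperiodic with unattained infimum (route RefuteCrystalPeriodicMin). -/
@[route_item "route-AtomisticToContinuum-CrystalKissingRigidity"]
def CrysPeriodicMinAttained : Prop :=
  ∃ P : Literature.MathematicalPhysics.StatisticalMechanics.PeriodicConfiguration 3, IsLeast (Set.range fun Q : Literature.MathematicalPhysics.StatisticalMechanics.PeriodicConfiguration 3 => Q.energyPerParticle Literature.MathematicalPhysics.StatisticalMechanics.lennardJones) (P.energyPerParticle Literature.MathematicalPhysics.StatisticalMechanics.lennardJones)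

/-- item stmt-AtomisticToContinuum-0752 · support · rank 9 · open · by planner
[support] SOFT ASSEMBLY LEMMA: BulkDefectVanish together with the uniform minimal distance of LJ
ground states (Literature fact LennardJonesMinimalDistance, Xue 1997 / BlancLewin2015 §2.2) implies
IsCrystallizing lennardJones 3: pick, for R_k = k, ε_k = 1/k, indices N_k ↑ and good particles i_k;
τ_k = −x_{i_k}; extract a convergent subsequence of the isometries A_k → A in O(3); minimal distance
+ discreteness of P make the ε-matching a local bijection, so Σ_i f(x_i + τ_k) → Σ_{s ∈ A(P.points)}
f(s) for f ∈ C_c; A(P) is again a PeriodicConfiguration (rotate lattice and motif), multiplicity m ≡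
1. -/
@[route_item "route-AtomisticToContinuum-CrystalKissingRigidity"]
def DefectVanishCrystallizes : Prop :=
  BulkDefectVanish → Literature.MathematicalPhysics.StatisticalMechanics.LennardJonesMinimalDistance → Literature.MathematicalPhysics.StatisticalMechanics.IsCrystallizing Literature.MathematicalPhysics.StatisticalMechanics.lennardJones 3

/-- item stmt-AtomisticToContinuum-0759 · support · rank 9 · closed · moot by None · by planner
[support] STACKING-FAULT BOUND: there is K < ∞ such that every N-particle Lennard-Jones ground state
in ℝ³, read through (K1)+(K2) as a Barlow stacking away from o(N) defective particles, has at most K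
misaligned (non-HCP) layer pairs meeting the bulk; because each fault plane crossing the cluster
costs ≥ (|J_2| − Σ_{k≥3} k|J_k|)·c N^{2/3} > 0 (Hägg domination 0716/0737 with the certified
couplings of 0670: J_2 ≈ −7.3e−5, ratio ≈ 250) while the total shape-dependent surface energy
available is ≤ C N^{2/3}. With ≤ K faults among ≍ N^{1/3} layers, pigeonhole gives fault-free slabs
of ≥ N^{1/3}/(K+1) layers, whence BulkDefectVanish for the HCP-type P. Sources: HaggStacking.lean;
PartayOrtnerCsanyi2017; Stillinger2001. -/
@[route_item "route-AtomisticToContinuum-CrystalKissingRigidity"]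
def StackingFaultBound : Prop :=
  ∃ C : ℝ → ℝ → ℝ, ∀ R ε : ℝ, 0 < R → 0 < ε → ε < 1 / 4 → ∀ (N : ℕ) (x : Fin N → EuclideanSpace ℝ (Fin 3)), Literature.MathematicalPhysics.StatisticalMechanics.IsGroundState Literature.MathematicalPhysics.StatisticalMechanics.lennardJones x → let M : Set (EuclideanSpace ℝ (Fin 3)) → Fin N → Prop := fun S i => ∃ z ∈ S, ∃ A : EuclideanSpace ℝ (Fin 3) →ₗᵢ[ℝ] EuclideanSpace ℝ (Fin 3), (∀ p ∈ S, dist p z ≤ R → ∃ j : Fin N, dist (x j) (x i + A (p - z)) ≤ ε) ∧ (∀ j : Fin N, dist (x j) (x i) ≤ R → ∃ p ∈ S, dist (x j) (x i + A (p - z)) ≤ ε); (Nat.card {i : Fin N // (∃ a h : ℝ, 1 / 2 < a ∧ a < 2 ∧ 1 / 2 < h ∧ h < 2 ∧ ∃ s : ℤ → ℤ, Literature.MathematicalPhysics.StatisticalMechanics.IsHaggSeq s ∧ M (Literature.MathematicalPhysics.StatisticalMechanics.barlowStacking a h s) i) ∧ ¬ ∃ a h : ℝ, 1 / 2 < a ∧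 a < 2 ∧ 1 / 2 < h ∧ h < 2 ∧ M (Literature.MathematicalPhysics.StatisticalMechanics.hcpStacking a h) i} : ℝ) ≤ C R ε * (N : ℝ) ^ (2 / 3 : ℝ)

/-- item stmt-AtomisticToContinuum-0753 · assembly · rank 1 · closed · moot by None · by planner
[assembly] BulkDefectVanish → LennardJonesMinimalDistance (Literature fact, hypothesis) → periodic
minimum attained (0627) → E(N)/N → ⨅ periodic (0626, bookkeeping: periodisation 0715 + trial blocks
0629 + stability) → Crystallization. Proof: DefectVanishCrystallizes gives IsCrystallizing;
IsLeast.csInf_eq turns the limit into HasPeriodicGroundStateEnergy (as in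
crystallization_of_isLeast_tendsto_isCrystallizing). -/
@[route_item "route-AtomisticToContinuum-CrystalKissingRigidity"]
def Assembly : Prop :=
  DefectVanishCrystallizes → BulkDefectVanish → Literature.MathematicalPhysics.StatisticalMechanics.LennardJonesMinimalDistance → (∃ P : Literature.MathematicalPhysics.StatisticalMechanics.PeriodicConfiguration 3, IsLeast (Set.range fun Q : Literature.MathematicalPhysics.StatisticalMechanics.PeriodicConfiguration 3 => Q.energyPerParticle Literature.MathematicalPhysics.StatisticalMechanics.lennardJones) (P.energyPerParticle Literature.MathematicalPhysics.StatisticalMechanics.lennardJones)) → Filter.Tendsto (fun N : ℕ => Literature.MathematicalPhysics.StatisticalMechanics.groundStateEnergy Literature.MathematicalPhysics.StatisticalMechanics.lennardJones 3 N / N) Filter.atTop (nhds (⨅ Q : Literature.MathematicalPhysics.StatisticalMechanics.PeriodicConfiguration 3, Q.energyPerParticle Literature.MathematicalPhysics.StatisticalMechanics.lennardJones)) → Literature.MathematicalPhysics.StatisticalMechanics.Crystallization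

end Summit.AtomisticToContinuum.Crystallization.Theses.CrystalKissingRigidity
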